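import Summits.KontsevichZagierPeriods.KontsevichZagierPeriods.Theorems.UnfoldedStokesStokesGenerationStubPolylogArgHomotopy
import Summits.KontsevichZagierPeriods.KontsevichZagierPeriods.Theorems.UnfoldedStokesStokesGenerationStubLogProductHomotopy
import Summits.KontsevichZagierPeriods.KontsevichZagierPeriods.Theorems.UnfoldedStokesStokesGenerationStubHillRelationA
import Summits.KontsevichZagierPeriods.KontsevichZagierPeriods.Theorems.UnfoldedStokesStokesGenerationStubHillRelationB
import Summits.KontsevichZagierPeriods.KontsevichZagierPeriods.Theorems.UnfoldedStokesStokesGenerationFibrewiseRungLanden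
import Summits.KontsevichZagierPeriods.KontsevichZagierPeriods.Theorems.UnfoldedStokesStokesGenerationStubLandenLeftovers
import Summits.KontsevichZagierPeriods.KontsevichZagierPeriods.Theorems.UnfoldedStokesStokesGenerationFibrewiseClosurePad

/-!
# `StokesGeneration` (stmt-KontsevichZagierPeriods-3586), line `fibrewise_stokes` — rung 19: the five-term relation of the
# dilogarithm is fibrewise-Stokes decomposable

Crux `Summit.KontsevichZagierPeriods.KontsevichZagierPeriods.Theses.UnfoldedStokes.StokesGeneration`; residual stub S2
`stub_fibrewiseStokesGeneration` (`FibStokesDecomposable`, `Theorems/UnfoldedStokesDefs.lean`). `Li₂(w)` (real algebraic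
`w < 1`) is the period of the bounded cube integrand `T_w(s,t) = w/(1 − wst)` on `[0,1]²`, and
`log(1 − a) − log(1 − b) = ∫₀¹ L(s) ds`, `L(s) = −a/(1−as) + b/(1−bs)`. The FIVE-TERM RELATION in Hill's form
`Li₂(ab) = Li₂(a) + Li₂(b) + Li₂(−a(1−b)/(1−a)) + Li₂(−b(1−a)/(1−b)) + ½log²((1−a)/(1−b))` (`|a|, |b| < 1`) is thus the
vanishing of the value of the cube integrand `T_{ab} − T_a − T_b − T_{w₁} − T_{w₂} − ½L(s)L(t)` (`w₁ = −a(1−b)/(1−a)`,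
`w₂ = −b(1−a)/(1−b)`), and this file proves that integrand fibrewise-Stokes decomposable at every pair of real algebraic
arguments (`fibStokesDecomposable_fiveTerm`). Since every functional equation of the dilogarithm with rational arguments is a
formal consequence of the five-term relation, this is the natural capstone of the weight-2 layer of the line (frontier item
C2 of lead c5's analysis: "dimension ≥ 2, non-separated; no Baker-type theorem exists; only value-free identities are
accessible" — here is the mother of them, value-free).

Certificate — transcendence-free and value-free. Homotopy `b ↦ bv` in a third cube coordinate `v`:
`F(s,t,v) = T_{abv} − T_a − T_{bv} − T_{w₁(v)} − T_{w₂(v)} − ½ℓ(s,v)ℓ(t,v)` with `w₁(v) = −a(1−bv)/(1−a)`,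
`w₂(v) = −bv(1−a)/(1−bv)`, `ℓ(s,v) = −a/(1−as) + bv/(1−bvs)`; `F|_{v=1}` is the five-term integrand and `F|_{v=0} = −`(Landen's
integrand at `a`), decomposable by rung 18 (`fibStokesDecomposable_landen`). The generic polylogarithm-argument homotopy
(`stub_polylogArgHomotopy`, four instances) and the log-product homotopy (`stub_logProductHomotopy`) trade `F|₁ − F|₀` for
one-dimensional integrands in `s` with the silent parameter `v` (closed-form rational primitives along `t` and `s`), modulo an
antisymmetrisation and a transposition (rung 12, `landenLeft_sub_comp_perm_of_contDiffOn`). What is left is, POINTWISE,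
`−b/(1−bv)` times the three-term dlog relation `std((1−abv)/(1−a)) + std(1−a) − std(1−abv)` plus `b/(1−bv)` times the reduced
relation `(1/bv)(std((1−abv)/(1−bv)) + std(1−bv) − std(1−abv))` (`std(R)(s) = (R−1)/(1 + s(R−1))`, `∫std(R) = log R`), each
certified fibrewise in `v` by rung 2's homotopy `E = 1 + (P−1)y` (`stub_hillRelationA`, `stub_hillRelationB`) — the
coefficient identities are rational, no period evaluation and no transcendence input enter.

References: D. Zagier, *The dilogarithm function* (2007), §I.2 (the five-term relation; Hill's and Abel's forms); M. Kontsevich,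
D. Zagier, *Periods* (2001), §1.1–1.2.
-/

noncomputable section

-- `Summit.KontsevichZagierPeriods.KontsevichZagierPeriods.…` is the tree's mandated layout (single-conjunct summit).
set_option linter.dupNamespace false

namespace Summit.KontsevichZagierPeriods.KontsevichZagierPeriods.Cruxes.StokesGeneration.FibrewiseStokes

open MeasureTheory Set
open Literature.NumberTheory.Transcendental
open Literature.NumberTheory.Transcendental.KZ
open Literature.ModelTheory.ExponentialFields (IsSemialgebraic)
open scoped Topology


/-- Positivity `0 < 1 − c·p` for `|c| < 1`, `p ∈ [0,1]`. [folklore] -/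
theorem fiveTerm_denom_pos {c p : ℝ} (hc : |c| < 1) (hp0 : 0 ≤ p) (hp1 : p ≤ 1) : 0 < 1 - c * p := by
  have h1 := abs_lt.mp hc
  rcases le_or_gt 0 c with hc0 | hc0 <;> nlinarith

/-- **Rung 19 (lead c6): the five-term relation of the dilogarithm is fibrewise-Stokes decomposable.** For real algebraic
`|a|, |b| < 1` the cube integrand of Hill's form of the Abel–Spence five-term relation,
`Li₂(ab) − Li₂(a) − Li₂(b) − Li₂(−a(1−b)/(1−a)) − Li₂(−b(1−a)/(1−b)) − ½(log(1−a) − log(1−b))² = 0`, on `[0,1]²` is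
decomposable. Certificate: the homotopy `b ↦ bv` in a third coordinate (`stub_polylogArgHomotopy` ×4,
`stub_logProductHomotopy`) down to `v = 0`, where the relation degenerates to Landen's identity (rung 18,
`fibStokesDecomposable_landen`); the one-dimensional leftovers with the silent parameter `v` are, pointwise,
`−b/(1−bv)` times the three-term dlog relation A plus `b/(1−bv)` times the reduced relation B (`stub_hillRelationA/B`), modulo a
transposition and an antisymmetrisation (rung 12). Transcendence-free and value-free: weight 2, two variables, genuinely
non-separated — the mother of the functional equations of `Li₂`. [cite: Zagier2007Dilogarithm, §I.2] -/
theorem fibStokesDecomposable_fiveTerm (a b : ℝ) (ha : IsAlgebraic ℚ a) (hb : IsAlgebraic ℚ b) (ha1 : |a| < 1) (hb1 : |b| < 1) :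
    FibStokesDecomposable 2 (fun x => a * b / (1 - a * b * x 0 * x 1) - a / (1 - a * x 0 * x 1) - b / (1 - b * x 0 * x 1) +
      a * (1 - b) / (1 - a + a * (1 - b) * x 0 * x 1) + b * (1 - a) / (1 - b + b * (1 - a) * x 0 * x 1) -
      (1 / 2) * ((-a / (1 - a * x 0) + b / (1 - b * x 0)) * (-a / (1 - a * x 1) + b / (1 - b * x 1)))) := by
  classical
  obtain ⟨ha0, ha1'⟩ := abs_lt.mp ha1
  obtain ⟨hb0, hb1'⟩ := abs_lt.mp hb1
  have hab : |a * b| < 1 := by rw [abs_mul]; nlinarith [abs_nonneg a, abs_nonneg b, abs_lt.mpr ⟨ha0, ha1'⟩]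
  have hS1 : IsSemialgebraic ℚ (Set.pi Set.univ (fun _ : Fin 1 => Set.Icc (0:ℝ) 1)) := by
    rw [← cube_eq_pi]; exact isSemialgebraic_cube
  have hS2 : IsSemialgebraic ℚ (Set.pi Set.univ (fun _ : Fin 2 => Set.Icc (0:ℝ) 1)) := by
    rw [← cube_eq_pi]; exact isSemialgebraic_cube
  have hI : ∀ {z : Fin 1 → ℝ}, z ∈ Set.pi Set.univ (fun _ : Fin 1 => Set.Icc (0:ℝ) 1) → 0 ≤ z 0 ∧ z 0 ≤ 1 :=
    fun hz => (Set.mem_univ_pi.mp hz) 0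
  have hI2 : ∀ {z : Fin 2 → ℝ}, z ∈ Set.pi Set.univ (fun _ : Fin 2 => Set.Icc (0:ℝ) 1) → ∀ i, 0 ≤ z i ∧ z i ≤ 1 :=
    fun hz i => (Set.mem_univ_pi.mp hz) i
  -- constants
  have calg : ∀ {t : ℝ}, IsAlgebraic ℚ t → IsSemialgebraicFunOn ℚ (Set.pi Set.univ (fun _ : Fin 1 => Set.Icc (0:ℝ) 1)) (fun _ => t) :=
    fun ht => isSemialgebraicFunOn_const_of_isAlgebraic hS1 ht
  have calg2 : ∀ {t : ℝ}, IsAlgebraic ℚ t → IsSemialgebraicFunOn ℚ (Set.pi Set.univ (fun _ : Fin 2 => Set.Icc (0:ℝ) 1)) (fun _ => t) :=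
    fun ht => isSemialgebraicFunOn_const_of_isAlgebraic hS2 ht
  have h1a : IsAlgebraic ℚ (1 - a) := isAlgebraic_one.sub ha
  have h1b : IsAlgebraic ℚ (1 - b) := isAlgebraic_one.sub hb
  have habA : IsAlgebraic ℚ (a * b) := ha.mul hb
  have z0 : IsSemialgebraicFunOn ℚ (Set.pi Set.univ (fun _ : Fin 1 => Set.Icc (0:ℝ) 1)) (fun z => z 0) := isSemialgebraicFunOn_apply hS1 0
  have y0 : IsSemialgebraicFunOn ℚ (Set.pi Set.univ (fun _ : Fin 2 => Set.Icc (0:ℝ) 1)) (fun z => z 0) := isSemialgebraicFunOn_apply hS2 0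
  have y1 : IsSemialgebraicFunOn ℚ (Set.pi Set.univ (fun _ : Fin 2 => Set.Icc (0:ℝ) 1)) (fun z => z 1) := isSemialgebraicFunOn_apply hS2 1
  ------------------------------------------------------------------
  -- (1) `Li₂(abv)`: `w v = a b v`, `w' = a b`
  have g₁ := stub_polylogArgHomotopy (fun v => a * b * v) (fun _ => a * b)
    ((calg habA).fun_mul z0) (calg habA)
    ((continuous_const.mul continuous_id).continuousOn) continuousOn_const
    (fun v _ => ((hasDerivAt_id' v).const_mul (a * b)).congr_deriv (mul_one _))
    (fun v hv => by
      have := fiveTerm_denom_pos hab hv.1 hv.2; linarith)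
  -- (2) `Li₂(bv)`: `w v = b v`, `w' = b`
  have g₂ := stub_polylogArgHomotopy (fun v => b * v) (fun _ => b)
    ((calg hb).fun_mul z0) (calg hb)
    ((continuous_const.mul continuous_id).continuousOn) continuousOn_const
    (fun v _ => ((hasDerivAt_id' v).const_mul b).congr_deriv (mul_one _))
    (fun v hv => by
      have := fiveTerm_denom_pos hb1 hv.1 hv.2; linarith)
  -- (3) `Li₂(w₁(v))`, `w₁ v = -a(1 - b v)/(1 - a)`, `w₁' = a b/(1 - a)`
  have h1a0 : (1 - a) ≠ 0 := by linarith
  have g₃ := stub_polylogArgHomotopy (fun v => -a * (1 - b * v) / (1 - a)) (fun _ => a * b / (1 - a))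
    ((((calg ha).fun_neg.fun_mul ((calg isAlgebraic_one).fun_sub ((calg hb).fun_mul z0))).div (calg h1a)
      (fun _ _ => h1a0)).congr fun z _ => by ring)
    (((calg habA).div (calg h1a) (fun _ _ => h1a0)).congr fun z _ => rfl)
    (by fun_prop) continuousOn_const
    (fun v _ => by
      have := ((((hasDerivAt_id' v).const_mul b).const_sub 1).const_mul (-a)).div_const (1 - a)
      exact this.congr_deriv (by field_simp))
    (fun v hv => by
      rw [div_lt_one (by linarith)]
      have := fiveTerm_denom_pos hab hv.1 hv.2; nlinarith)
  -- (4) `Li₂(w₂(v))`, `w₂ v = -b v (1 - a)/(1 - b v)`, `w₂' v = -b(1 - a)/(1 - b v)^2`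
  have hbv : ∀ v ∈ Set.Icc (0:ℝ) 1, 0 < 1 - b * v := fun v hv => fiveTerm_denom_pos hb1 hv.1 hv.2
  have g₄ := stub_polylogArgHomotopy (fun v => -b * v * (1 - a) / (1 - b * v)) (fun v => -b * (1 - a) / (1 - b * v) ^ 2)
    (((((calg hb).fun_neg.fun_mul z0).fun_mul (calg h1a)).div ((calg isAlgebraic_one).fun_sub ((calg hb).fun_mul z0))
      (fun z hz => (hbv _ (hI hz)).ne')).congr fun z _ => by ring)
    ((((calg hb).fun_neg.fun_mul (calg h1a)).div (((calg isAlgebraic_one).fun_sub ((calg hb).fun_mul z0)).fun_pow 2)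
      (fun z hz => pow_ne_zero 2 (hbv _ (hI hz)).ne')).congr fun z _ => by ring)
    (by
      refine ContinuousOn.div (by fun_prop) (by fun_prop) fun v hv => (hbv v hv).ne')
    (by
      refine ContinuousOn.div (by fun_prop) (by fun_prop) fun v hv => pow_ne_zero 2 (hbv v hv).ne')
    (fun v hv => by
      have hne : (1 - b * v) ≠ 0 := (hbv v (Set.Ioo_subset_Icc_self hv)).ne'
      have hnum := ((hasDerivAt_id' v).const_mul (-b)).mul_const (1 - a)
      have hden := ((hasDerivAt_id' v).const_mul b).const_sub 1
      exact (hnum.fun_div hden hne).congr_deriv (by field_simp; ring))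
    (fun v hv => by
      rw [div_lt_one (hbv v hv)]
      have := fiveTerm_denom_pos hab hv.1 hv.2; nlinarith)
  ------------------------------------------------------------------
  -- (5) the log-product term: `ℓ(s,v) = -a/(1 - a s) + b v/(1 - b v s)`, `ℓᵥ = b/(1 - b v s)^2`, `μ = b s/(1 - b v s)`
  have hbvs : ∀ z ∈ Set.pi Set.univ (fun _ : Fin 2 => Set.Icc (0:ℝ) 1), 0 < 1 - b * z 1 * z 0 := by
    intro z hz
    have h := hI2 hz
    have hp : 0 ≤ z 1 * z 0 ∧ z 1 * z 0 ≤ 1 := ⟨mul_nonneg (h 1).1 (h 0).1, by nlinarith [(h 1).2, (h 0).2, (h 1).1, (h 0).1]⟩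
    have := fiveTerm_denom_pos hb1 hp.1 hp.2; rw [mul_assoc]; exact this
  have has : ∀ z ∈ Set.pi Set.univ (fun _ : Fin 2 => Set.Icc (0:ℝ) 1), 0 < 1 - a * z 0 :=
    fun z hz => fiveTerm_denom_pos ha1 (hI2 hz 0).1 (hI2 hz 0).2
  have g₅ := stub_logProductHomotopy (fun s v => -a / (1 - a * s) + b * v / (1 - b * v * s))
    (fun s v => b / (1 - b * v * s) ^ 2) (fun s v => b * s / (1 - b * v * s))
    (((calg2 ha).fun_neg.div ((calg2 isAlgebraic_one).fun_sub ((calg2 ha).fun_mul y0)) (fun z hz => (has z hz).ne')).fun_add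
      (((calg2 hb).fun_mul y1).div ((calg2 isAlgebraic_one).fun_sub (((calg2 hb).fun_mul y1).fun_mul y0))
        (fun z hz => (hbvs z hz).ne')))
    ((calg2 hb).div (((calg2 isAlgebraic_one).fun_sub (((calg2 hb).fun_mul y1).fun_mul y0)).fun_pow 2)
      (fun z hz => pow_ne_zero 2 (hbvs z hz).ne'))
    (((calg2 hb).fun_mul y0).div ((calg2 isAlgebraic_one).fun_sub (((calg2 hb).fun_mul y1).fun_mul y0))
      (fun z hz => (hbvs z hz).ne'))
    (by
      refine ContinuousOn.add (ContinuousOn.div (by fun_prop) (by fun_prop) fun z hz => (has z hz).ne') ?_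
      exact ContinuousOn.div (by fun_prop) (by fun_prop) fun z hz => (hbvs z hz).ne')
    (ContinuousOn.div (by fun_prop) (by fun_prop) fun z hz => pow_ne_zero 2 (hbvs z hz).ne')
    (ContinuousOn.div (by fun_prop) (by fun_prop) fun z hz => (hbvs z hz).ne')
    (fun s hs v hv => by
      have hne : 1 - b * v * s ≠ 0 := by
        have := hbvs ![s, v] (Set.mem_univ_pi.mpr (Fin.forall_fin_two.mpr ⟨hs, Set.Ioo_subset_Icc_self hv⟩))
        simpa using this.ne'
      have hnum := (hasDerivAt_id' v).const_mul b
      have hden := (((hasDerivAt_id' v).const_mul b).mul_const s).const_sub 1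
      have h3 := (hnum.fun_div hden hne).const_add (-a / (1 - a * s))
      exact h3.congr_deriv (by field_simp; ring))
    (fun v hv s hs => by
      have hne : 1 - b * v * s ≠ 0 := by
        have := hbvs ![s, v] (Set.mem_univ_pi.mpr (Fin.forall_fin_two.mpr ⟨Set.Ioo_subset_Icc_self hs, hv⟩))
        simpa using this.ne'
      have hnum := (hasDerivAt_id' s).const_mul b
      have hden := ((hasDerivAt_id' s).const_mul (b * v)).const_sub 1
      exact (hnum.fun_div hden hne).congr_deriv (by field_simp; ring))
    (fun v _ => by simp)
  ------------------------------------------------------------------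
  -- (6) the parametric dlog certificates with coefficients `∓ b/(1 - b v)`
  have hγsa : IsSemialgebraicFunOn ℚ (Set.pi Set.univ (fun _ : Fin 1 => Set.Icc (0:ℝ) 1)) (fun z => b / (1 - b * z 0)) :=
    (calg hb).div ((calg isAlgebraic_one).fun_sub ((calg hb).fun_mul z0)) fun z hz => (hbv _ (hI hz)).ne'
  have hγc : ContinuousOn (fun v => b / (1 - b * v)) (Set.Icc (0:ℝ) 1) :=
    ContinuousOn.div (by fun_prop) (by fun_prop) fun v hv => (hbv v hv).ne'
  have hA := stub_hillRelationA a b ha hb ha1 hb1 (fun v => -(b / (1 - b * v))) (hγsa.fun_neg) hγc.neg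
  have hB := stub_hillRelationB a b ha hb ha1 hb1 (fun v => b / (1 - b * v)) hγsa hγc
  ------------------------------------------------------------------
  -- (7) Landen at `a`, padded to `[0,1]³`
  have hle : 2 ≤ 3 := by norm_num
  have hL := fibStokesDecomposable_pad 2 3 hle _ (fibStokesDecomposable_landen a ha ha1')
  ------------------------------------------------------------------
  -- (8) the soft leftovers: a transposition and an antisymmetrisation (rung 12)
  obtain ⟨U, hU⟩ : ∃ U : Set (Fin 3 → ℝ), U = {x | 0 < 1 - a * x 0 ∧ 0 < 1 - a * x 1 ∧ 0 < 1 - b * x 2 * x 0 ∧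
      0 < 1 - b * x 2 * x 1 ∧ 0 < 1 - b * x 2} := ⟨_, rfl⟩
  have hUo : IsOpen U := by
    have c0 : Continuous fun x : Fin 3 → ℝ => 1 - a * x 0 := by fun_prop
    have c1 : Continuous fun x : Fin 3 → ℝ => 1 - a * x 1 := by fun_prop
    have c2 : Continuous fun x : Fin 3 → ℝ => 1 - b * x 2 * x 0 := by fun_prop
    have c3 : Continuous fun x : Fin 3 → ℝ => 1 - b * x 2 * x 1 := by fun_prop
    have c4 : Continuous fun x : Fin 3 → ℝ => 1 - b * x 2 := by fun_prop
    rw [hU]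
    exact (isOpen_lt continuous_const c0).inter ((isOpen_lt continuous_const c1).inter
      ((isOpen_lt continuous_const c2).inter ((isOpen_lt continuous_const c3).inter (isOpen_lt continuous_const c4))))
  have hUsa : IsSemialgebraic ℚ U := by
    have hV : IsSemialgebraic ℚ (Set.univ : Set (Fin 3 → ℝ)) :=
      Literature.ModelTheory.ExponentialFields.isSemialgebraic_univ
    have sx : ∀ i, IsSemialgebraicFunOn ℚ (Set.univ : Set (Fin 3 → ℝ)) (fun x => x i) := fun i =>
      isSemialgebraicFunOn_apply hV i
    have sa : IsSemialgebraicFunOn ℚ (Set.univ : Set (Fin 3 → ℝ)) (fun _ => a) := isSemialgebraicFunOn_const_of_isAlgebraic hV ha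
    have sb : IsSemialgebraicFunOn ℚ (Set.univ : Set (Fin 3 → ℝ)) (fun _ => b) := isSemialgebraicFunOn_const_of_isAlgebraic hV hb
    have s1 : IsSemialgebraicFunOn ℚ (Set.univ : Set (Fin 3 → ℝ)) (fun _ => (1:ℝ)) := by
      simpa using isSemialgebraicFunOn_const_natCast hV 1
    have n0 := ((sa.fun_mul (sx 0)).fun_sub s1).isSemialgebraic_sep_neg
    have n1 := ((sa.fun_mul (sx 1)).fun_sub s1).isSemialgebraic_sep_neg
    have n2 := (((sb.fun_mul (sx 2)).fun_mul (sx 0)).fun_sub s1).isSemialgebraic_sep_neg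
    have n3 := (((sb.fun_mul (sx 2)).fun_mul (sx 1)).fun_sub s1).isSemialgebraic_sep_neg
    have n4 := ((sb.fun_mul (sx 2)).fun_sub s1).isSemialgebraic_sep_neg
    rw [hU]
    convert n0.inter (n1.inter (n2.inter (n3.inter n4))) using 1
    ext x
    simp only [Set.mem_setOf_eq, Set.mem_inter_iff, Set.mem_univ, true_and, sub_pos, sub_neg]
  have hCU : Set.pi Set.univ (fun _ : Fin 3 => Set.Icc (0:ℝ) 1) ⊆ U := by
    intro x hx
    have hm : ∀ i, x i ∈ Set.Icc (0:ℝ) 1 := fun i => (Set.mem_univ_pi.mp hx) i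
    have hprod : ∀ i j, 0 < 1 - b * x i * x j := fun i j => by
      rw [mul_assoc]
      exact fiveTerm_denom_pos hb1 (mul_nonneg (hm i).1 (hm j).1) (mul_le_one₀ (hm i).2 (hm j).1 (hm j).2)
    rw [hU]
    exact ⟨fiveTerm_denom_pos ha1 (hm 0).1 (hm 0).2, fiveTerm_denom_pos ha1 (hm 1).1 (hm 1).2, hprod 2 0, hprod 2 1,
      fiveTerm_denom_pos hb1 (hm 2).1 (hm 2).2⟩
  have hDa0 : ∀ x ∈ U, 1 - a * x 0 ≠ 0 := fun x hx => by rw [hU] at hx; exact hx.1.ne'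
  have hDa1 : ∀ x ∈ U, 1 - a * x 1 ≠ 0 := fun x hx => by rw [hU] at hx; exact hx.2.1.ne'
  have hDb0 : ∀ x ∈ U, 1 - b * x 2 * x 0 ≠ 0 := fun x hx => by rw [hU] at hx; exact hx.2.2.1.ne'
  have hDb1 : ∀ x ∈ U, 1 - b * x 2 * x 1 ≠ 0 := fun x hx => by rw [hU] at hx; exact hx.2.2.2.1.ne'
  have hDb2 : ∀ x ∈ U, 1 - b * x 2 ≠ 0 := fun x hx => by rw [hU] at hx; exact hx.2.2.2.2.ne'
  have hDb1sq : ∀ x ∈ U, (1 - b * x 2 * x 1) ^ 2 ≠ 0 := fun x hx => pow_ne_zero 2 (hDb1 x hx)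
  -- semialgebraic atoms on `U`
  have ux : ∀ i, IsSemialgebraicFunOn ℚ U (fun x => x i) := fun i => isSemialgebraicFunOn_apply hUsa i
  have ua : IsSemialgebraicFunOn ℚ U (fun _ => a) := isSemialgebraicFunOn_const_of_isAlgebraic hUsa ha
  have ub : IsSemialgebraicFunOn ℚ U (fun _ => b) := isSemialgebraicFunOn_const_of_isAlgebraic hUsa hb
  have u1 : IsSemialgebraicFunOn ℚ U (fun _ => (1:ℝ)) := by simpa using isSemialgebraicFunOn_const_natCast hUsa 1
  have uhalf : IsSemialgebraicFunOn ℚ U (fun _ => (1 / 2 : ℝ)) :=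
    (isSemialgebraicFunOn_const_ratCast hUsa (1 / 2)).congr fun _ _ => by norm_num
  have uDa0 : IsSemialgebraicFunOn ℚ U (fun x => 1 - a * x 0) := u1.fun_sub (ua.fun_mul (ux 0))
  have uDb0 : IsSemialgebraicFunOn ℚ U (fun x => 1 - b * x 2 * x 0) := u1.fun_sub ((ub.fun_mul (ux 2)).fun_mul (ux 0))
  have uDb1 : IsSemialgebraicFunOn ℚ U (fun x => 1 - b * x 2 * x 1) := u1.fun_sub ((ub.fun_mul (ux 2)).fun_mul (ux 1))
  have uDb2 : IsSemialgebraicFunOn ℚ U (fun x => 1 - b * x 2) := u1.fun_sub (ub.fun_mul (ux 2))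
  have uℓ0 : IsSemialgebraicFunOn ℚ U (fun x => -a / (1 - a * x 0) + b * x 2 / (1 - b * x 2 * x 0)) :=
    (ua.fun_neg.div uDa0 hDa0).fun_add ((ub.fun_mul (ux 2)).div uDb0 hDb0)
  -- (8a) the antisymmetrisation `½(ℓ(x₀)ℓᵥ(x₁) − ℓᵥ(x₀)ℓ(x₁)) = h − h∘σ₀₁`
  have hanti := landenLeft_sub_comp_perm_of_contDiffOn U hUo hCU
    (fun x => (1 / 2) * ((-a / (1 - a * x 0) + b * x 2 / (1 - b * x 2 * x 0)) * (b / (1 - b * x 2 * x 1) ^ 2)))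
    (uhalf.fun_mul (uℓ0.fun_mul (ub.div (uDb1.fun_pow 2) hDb1sq)))
    (by fun_prop (disch := assumption)) (Equiv.swap 0 1)
  -- (8b) the transposition `μ(1,x₂)(ℓ(x₀,x₂) − ℓ(x₁,x₂)) = g − g∘σ₀₁`
  have hswap := landenLeft_sub_comp_perm_of_contDiffOn U hUo hCU
    (fun x => b / (1 - b * x 2) * (-a / (1 - a * x 0) + b * x 2 / (1 - b * x 2 * x 0)))
    ((ub.div uDb2 hDb2).fun_mul uℓ0)
    (by fun_prop (disch := assumption)) (Equiv.swap 0 1)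
  ------------------------------------------------------------------
  -- (9) sum up: `H = hA + hB + hswap − hanti − g₁ + g₂ + g₃ + g₄ + g₅ − hL` on the cube
  have hS := fibStokesDecomposable_sub 3 _ _
    (fibStokesDecomposable_add 3 _ _
      (fibStokesDecomposable_add 3 _ _
        (fibStokesDecomposable_add 3 _ _
          (fibStokesDecomposable_add 3 _ _
            (fibStokesDecomposable_sub 3 _ _
              (fibStokesDecomposable_sub 3 _ _
                (fibStokesDecomposable_add 3 _ _ (fibStokesDecomposable_add 3 _ _ hA hB) hswap) hanti) g₁) g₂) g₃) g₄) g₅) hL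
  refine fibStokesDecomposable_unpad hle _ (fibStokesDecomposable_congr_off_null 3 _ _ ∅
    Literature.ModelTheory.ExponentialFields.isSemialgebraic_empty measure_empty (fun x hx _ => ?_) hS)
  -- the pointwise identity on the cube
  have hxU : x ∈ U := hCU hx
  rw [hU] at hxU
  obtain ⟨da0, da1, db20, db21, db2⟩ := hxU
  have hm : ∀ i, x i ∈ Set.Icc (0:ℝ) 1 := fun i => (Set.mem_univ_pi.mp hx) i
  have e0 : x (Fin.castLE hle 0) = x 0 := rfl
  have e1 : x (Fin.castLE hle 1) = x 1 := rfl
  have hne20 : (2 : Fin 3) ≠ 0 := by decide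
  have hne21 : (2 : Fin 3) ≠ 1 := by decide
  simp only [e0, e1, Equiv.swap_apply_left, Equiv.swap_apply_right,
    Equiv.swap_apply_of_ne_of_ne hne20 hne21, mul_one, mul_zero, zero_mul, sub_zero, zero_div, add_zero]
  -- positivity of all denominators at the point `x`
  have hp01 : 0 ≤ x 0 * x 1 ∧ x 0 * x 1 ≤ 1 := ⟨mul_nonneg (hm 0).1 (hm 1).1, mul_le_one₀ (hm 0).2 (hm 1).1 (hm 1).2⟩
  have hden : ∀ {c r : ℝ}, |c| < 1 → |r| ≤ 1 → 0 < 1 - c * r := by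
    intro c r hc hr
    have h1 : |c * r| < 1 := by
      rw [abs_mul]
      calc |c| * |r| ≤ |c| * 1 := mul_le_mul_of_nonneg_left hr (abs_nonneg c)
        _ < 1 := by simpa using hc
    linarith [(abs_lt.mp h1).2]
  have hr : ∀ {q p : ℝ}, 0 ≤ q → q ≤ 2 → 0 ≤ p → p ≤ 1 → |1 - q * p| ≤ 1 := by
    intro q p hq0 hq2 hp0 hp1
    have : q * p ≤ 2 := by nlinarith
    exact abs_le.mpr ⟨by nlinarith [mul_nonneg hq0 hp0], by nlinarith [mul_nonneg hq0 hp0]⟩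
  have habs1 : ∀ {p : ℝ}, 0 ≤ p → p ≤ 1 → |p| ≤ 1 := fun hp0 hp1 => abs_le.mpr ⟨by linarith, hp1⟩
  have h1a : 0 < 1 - a := by linarith
  have h1b : 0 < 1 - b := by linarith
  have hbx2 : |b * x 2| < 1 := by
    rw [abs_mul, abs_of_nonneg (hm 2).1]
    nlinarith [abs_nonneg b, (hm 2).1, (hm 2).2, abs_lt.mpr ⟨hb0, hb1'⟩]
  have d_a0 : 0 < 1 - a * x 0 := hden ha1 (habs1 (hm 0).1 (hm 0).2)
  have d_a1 : 0 < 1 - a * x 1 := hden ha1 (habs1 (hm 1).1 (hm 1).2)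
  have d_b0 : 0 < 1 - b * x 0 := hden hb1 (habs1 (hm 0).1 (hm 0).2)
  have d_b1 : 0 < 1 - b * x 1 := hden hb1 (habs1 (hm 1).1 (hm 1).2)
  have d_b2 : 0 < 1 - b * x 2 := hden hb1 (habs1 (hm 2).1 (hm 2).2)
  have d_b20 : 0 < 1 - b * x 2 * x 0 := by rw [mul_assoc]; exact db20 |> fun h => by rw [mul_assoc] at h; exact h
  have d_b21 : 0 < 1 - b * x 2 * x 1 := db21
  have d_ab20 : 0 < 1 - a * b * x 2 * x 0 := by
    have := hden hab (habs1 (mul_nonneg (hm 2).1 (hm 0).1) (mul_le_one₀ (hm 2).2 (hm 0).1 (hm 0).2))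
    rw [mul_assoc (a * b)]; exact this
  have d_ab01 : 0 < 1 - a * b * x 0 * x 1 := by
    have := hden hab (habs1 hp01.1 hp01.2); rw [mul_assoc (a * b)]; exact this
  have d_a01 : 0 < 1 - a * x 0 * x 1 := by have := hden ha1 (habs1 hp01.1 hp01.2); rw [mul_assoc]; exact this
  have d_b01 : 0 < 1 - b * x 0 * x 1 := by have := hden hb1 (habs1 hp01.1 hp01.2); rw [mul_assoc]; exact this
  have hq2 : 0 ≤ 1 - b * x 2 ∧ 1 - b * x 2 ≤ 2 := ⟨d_b2.le, by nlinarith [(abs_lt.mp hbx2).1]⟩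
  have hqb : 0 ≤ 1 - b ∧ 1 - b ≤ 2 := ⟨h1b.le, by linarith⟩
  have hqa : 0 ≤ 1 - a ∧ 1 - a ≤ 2 := ⟨h1a.le, by linarith⟩
  have d_A : 0 < 1 - a + a * (1 - b * x 2) * x 0 := by
    have := hden ha1 (hr hq2.1 hq2.2 (hm 0).1 (hm 0).2)
    have e : 1 - a + a * (1 - b * x 2) * x 0 = 1 - a * (1 - (1 - b * x 2) * x 0) := by ring
    rw [e]; exact this
  have d_A1 : 0 < 1 - a + a * (1 - b) * x 0 * x 1 := by
    have := hden ha1 (hr hqb.1 hqb.2 hp01.1 hp01.2)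
    have e : 1 - a + a * (1 - b) * x 0 * x 1 = 1 - a * (1 - (1 - b) * (x 0 * x 1)) := by ring
    rw [e]; exact this
  have d_A0 : 0 < 1 - a + a * x 0 * x 1 := by
    have := hden ha1 (hr zero_le_one (by norm_num) hp01.1 hp01.2)
    have e : 1 - a + a * x 0 * x 1 = 1 - a * (1 - 1 * (x 0 * x 1)) := by ring
    rw [e]; exact this
  have d_B : 0 < 1 - b * x 2 + b * x 2 * (1 - a) * x 0 := by
    have := hden hbx2 (hr hqa.1 hqa.2 (hm 0).1 (hm 0).2)
    have e : 1 - b * x 2 + b * x 2 * (1 - a) * x 0 = 1 - b * x 2 * (1 - (1 - a) * x 0) := by ring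
    rw [e]; exact this
  have d_B1 : 0 < 1 - b + b * (1 - a) * x 0 * x 1 := by
    have := hden hb1 (hr hqa.1 hqa.2 hp01.1 hp01.2)
    have e : 1 - b + b * (1 - a) * x 0 * x 1 = 1 - b * (1 - (1 - a) * (x 0 * x 1)) := by ring
    rw [e]; exact this
  have n_a0 := d_a0.ne'; have n_a1 := d_a1.ne'; have n_b0 := d_b0.ne'; have n_b1 := d_b1.ne'; have n_b2 := d_b2.ne'
  have n_b20 := d_b20.ne'; have n_b21 := d_b21.ne'; have n_ab20 := d_ab20.ne'; have n_ab01 := d_ab01.ne'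
  have n_a01 := d_a01.ne'; have n_b01 := d_b01.ne'; have n_A := d_A.ne'; have n_A1 := d_A1.ne'; have n_A0 := d_A0.ne'
  have n_B := d_B.ne'; have n_B1 := d_B1.ne'; have n_1a := h1a.ne'; have n_1b := h1b.ne'
  -- local identities
  have iV : -(b / (1 - b * x 2)) *
        (a * (1 - b * x 2) / (1 - a + a * (1 - b * x 2) * x 0) - a / (1 - a * x 0) +
          a * b * x 2 / (1 - a * b * x 2 * x 0)) +
      b / (1 - b * x 2) *
        ((1 - a) / (1 - b * x 2 + b * x 2 * (1 - a) * x 0) - 1 / (1 - b * x 2 * x 0) +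
          a / (1 - a * b * x 2 * x 0)) =
      a * b / (1 - a * b * x 2 * x 0) - b / (1 - b * x 2 * x 0) - a * b / (1 - a + a * (1 - b * x 2) * x 0) +
        b * (1 - a) / ((1 - b * x 2) * (1 - b * x 2 + b * x 2 * (1 - a) * x 0)) -
        b / (1 - b * x 2) * (-a / (1 - a * x 0) + b * x 2 / (1 - b * x 2 * x 0)) := by
    field_simp
    ring
  have c1 : 1 - -a * (1 - b * x 2) / (1 - a) * x 0 = (1 - a + a * (1 - b * x 2) * x 0) / (1 - a) := by
    field_simp; ring
  have c2 : 1 - -b * x 2 * (1 - a) / (1 - b * x 2) * x 0 = (1 - b * x 2 + b * x 2 * (1 - a) * x 0) / (1 - b * x 2) := by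
    field_simp; ring
  have c3 : 1 - -a * (1 - b) / (1 - a) * x 0 * x 1 = (1 - a + a * (1 - b) * x 0 * x 1) / (1 - a) := by
    field_simp; ring
  have c4 : 1 - -a / (1 - a) * x 0 * x 1 = (1 - a + a * x 0 * x 1) / (1 - a) := by
    field_simp; ring
  have c5 : 1 - -b * (1 - a) / (1 - b) * x 0 * x 1 = (1 - b + b * (1 - a) * x 0 * x 1) / (1 - b) := by
    field_simp; ring
  have i1 : a * b / (1 - a) / (1 - -a * (1 - b * x 2) / (1 - a) * x 0) = a * b / (1 - a + a * (1 - b * x 2) * x 0) := by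
    rw [c1]; field_simp
  have i2 : -b * (1 - a) / (1 - b * x 2) ^ 2 / (1 - -b * x 2 * (1 - a) / (1 - b * x 2) * x 0) =
      -(b * (1 - a) / ((1 - b * x 2) * (1 - b * x 2 + b * x 2 * (1 - a) * x 0))) := by
    rw [c2]; field_simp
  have i3 : -a * (1 - b) / (1 - a) / (1 - -a * (1 - b) / (1 - a) * x 0 * x 1) =
      -(a * (1 - b) / (1 - a + a * (1 - b) * x 0 * x 1)) := by
    rw [c3]; field_simp
  have i4 : -a / (1 - a) / (1 - -a / (1 - a) * x 0 * x 1) = -(a / (1 - a + a * x 0 * x 1)) := by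
    rw [c4]; field_simp
  have i5 : -b * (1 - a) / (1 - b) / (1 - -b * (1 - a) / (1 - b) * x 0 * x 1) =
      -(b * (1 - a) / (1 - b + b * (1 - a) * x 0 * x 1)) := by
    rw [c5]; field_simp
  rw [iV, i1, i2, i3, i4, i5]
  ring


end Summit.KontsevichZagierPeriods.KontsevichZagierPeriods.Cruxes.StokesGeneration.FibrewiseStokes

end
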